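import Summits.Ventures.CertifiedManyBodySolver.Upper.IntervalReaderWitness

/-!
# Ventures/CertifiedManyBodySolver — Upper/IntervalReaderChainEnergy.lean: `⟨ψ|H|ψ⟩` of an open-chain witness IS a sum of sweeps
(part 8 of the Theorem-H1′ package; parts 1–7: `IntervalReaderSchur`, `IntervalReaderTransfer`,
`IntervalReaderH1`, `IntervalReaderBridge`, `IntervalReaderMoments`, `IntervalReaderWitness`, `IntervalReaderAutomaton`)

HONEST FRAMING: first certified bounds; not a superconductivity verdict; every number certified or labelled
float.  Pure algebra: an IDENTITY for the quantity a certificate sentence speaks about; it certifies no number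
and moves no row.

For the FORMAT-fmps1 / METHOD-fmps class (doped open Hubbard CHAINS, `Certificates/HubbardChain_*_fmps_upper*`),
the certificate sentence of the consumer `Upper/FMPSConsumer.lean` is
`Re (star ψ ⬝ᵥ (toSpin (hamiltonian (pathGraph a) t U) *ᵥ ψ)) ≤ (a · hi) · Re (star ψ ⬝ᵥ ψ)` for the witness
`ψ = mpsOpenVar a A l r`.  Part 6 turned `star ψ ⬝ᵥ ψ` and every product-operator matrix element into a swept
boundary pairing (`sweepPairing` below = `star r ⬝ᵥ (envSweep … ((star l) ⊗ l′) *ᵥ r′)`); the tree's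
`JordanWigner.toSpin_hamiltonian_pathGraph_productOp` (Essler et al. §12.3.4) writes the open-chain Hubbard
Hamiltonian in the Jordan–Wigner product basis as a SUM OF PRODUCT OPERATORS (two-site bond words
`(c†_σ F)_i (c_σ)_{i+1}`, `(F c_σ)_i (c†_σ)_{i+1}` — no string beyond the bond — and on-site `n_↑ n_↓`).  Hence
(`inner_toSpin_hamiltonian_pathGraph_mpsOpenVar`):

`star ψ ⬝ᵥ (toSpin H ψ) = −t · Σ_{i+1=j} Σ_σ [S(bond word 1) + S(bond word 2)] + U · Σ_i S((n_↑n_↓)_i)`,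

each `S(·)` a ONE-state sweep of part 2's `transferOp` over the witness tensors.  Together with
`star_dotProduct_mpsOpenVar_eq_envSweep` (part 6) BOTH sides of the fmps1 certificate sentence are now explicit
finite contractions of the integer witness data — the exact quantities Theorem H1′ (`h1_sweep_error_le`) encloses
and `accept_sound` compares; for this class nothing of "the automaton represents `H`" is left outside the tree
(the reader's own automaton groups the same words differently; the VALUE is this one).  Evaluating the
contractions is the reader's job (kit), not Lean's.
-/

noncomputable section

open Matrix Finset
open scoped BigOperators ComplexOrder

namespace Summit.Ventures.CertifiedManyBodySolver.Upper.IntervalReader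

open Literature.MathematicalPhysics.QuantumLattice
open Literature.MathematicalPhysics.QuantumLattice.JordanWigner

variable {q D : ℕ}

/-! ## §N  The swept boundary pairing of a family of site operators -/

/-- The swept boundary pairing of part 6: `star r ⬝ᵥ (envSweep L A O ((star l) ⊗ l′) *ᵥ r′)` — the number the
exact one-state sweep with site operators `O` produces from the witness tensors and boundary vectors. -/
def sweepPairing (L : ℕ) (A : Fin L → MPSTensor q D) (O : Fin L → Matrix (Fin q) (Fin q) ℂ)
    (l l' r r' : Fin D → ℂ) : ℂ :=
  star r ⬝ᵥ (envSweep L A O (vecMulVec (star l) l') *ᵥ r')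

/-- **Matrix elements of product operators are sweeps** (part 6 in the tree's `productOp` vocabulary):
`star (mpsOpenVar L A l r) ⬝ᵥ (productOp O *ᵥ mpsOpenVar L A l′ r′) = sweepPairing L A O l l′ r r′`. -/
theorem inner_productOp_mpsOpenVar (L : ℕ) (A : Fin L → MPSTensor q D) (O : Fin L → Matrix (Fin q) (Fin q) ℂ)
    (l l' r r' : Fin D → ℂ) :
    star (mpsOpenVar L A l r) ⬝ᵥ (productOp O *ᵥ mpsOpenVar L A l' r') = sweepPairing L A O l l' r r' :=
  inner_mulVec_mpsOpenVar_eq_envSweep L A O (productOp O) (productOp_apply O) l l' r r'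

/-! ## §O  The open Hubbard chain -/

/-- **`⟨ψ|H|ψ⟩` of an open-chain MPS witness is a finite sum of one-state sweeps.**  For the open Hubbard chain
on `Fin N` in the site-major Jordan–Wigner product basis (`toSpin_hamiltonian_pathGraph_productOp`) and the
witness `ψ = mpsOpenVar N A l r`:
`star ψ ⬝ᵥ (toSpin (hamiltonian (pathGraph N) t U) *ᵥ ψ)`
`= −t · Σ_{i,j : i+1=j} Σ_σ [S (c†_σ F at i, c_σ at j) + S (F c_σ at i, c†_σ at j)] + U · Σ_i S (n_↑n_↓ at i)`
with `S O = sweepPairing N A O l l r r` and all other factors of each family equal to `1`. -/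
theorem inner_toSpin_hamiltonian_pathGraph_mpsOpenVar (N : ℕ) [DecidableRel (SimpleGraph.pathGraph N).Adj]
    (t U : ℝ) (A : Fin N → MPSTensor 4 D) (l r : Fin D → ℂ) :
    star (mpsOpenVar N A l r) ⬝ᵥ (toSpin (hamiltonian (SimpleGraph.pathGraph N) t U) *ᵥ mpsOpenVar N A l r) =
      -(t : ℂ) * (∑ i : Fin N, ∑ j : Fin N, if i.val + 1 = j.val then
          ∑ σ : Fin 2,
            (sweepPairing N A (Function.update (Function.update (fun _ => (1 : Matrix (Fin 4) (Fin 4) ℂ))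
                j (siteAnnihilation σ)) i (siteCreation σ * siteParity)) l l r r +
              sweepPairing N A (Function.update (Function.update (fun _ => (1 : Matrix (Fin 4) (Fin 4) ℂ))
                j (siteCreation σ)) i (siteParity * siteAnnihilation σ)) l l r r)
        else 0) +
      (U : ℂ) * ∑ i : Fin N, sweepPairing N A (Function.update (fun _ => (1 : Matrix (Fin 4) (Fin 4) ℂ))
        i siteDouble) l l r r := by
  rw [toSpin_hamiltonian_pathGraph_productOp, add_mulVec, dotProduct_add, smul_mulVec, smul_mulVec,
    dotProduct_smul, dotProduct_smul, smul_eq_mul, smul_eq_mul, Matrix.sum_mulVec, dotProduct_sum,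
    Matrix.sum_mulVec, dotProduct_sum]
  congr 2
  · refine Finset.sum_congr rfl fun i _ => ?_
    rw [Matrix.sum_mulVec, dotProduct_sum]
    refine Finset.sum_congr rfl fun j _ => ?_
    by_cases hij : i.val + 1 = j.val
    · rw [if_pos hij, if_pos hij, Matrix.sum_mulVec, dotProduct_sum]
      refine Finset.sum_congr rfl fun σ _ => ?_
      rw [add_mulVec, dotProduct_add, inner_productOp_mpsOpenVar, inner_productOp_mpsOpenVar]
    · rw [if_neg hij, if_neg hij, zero_mulVec, dotProduct_zero]
  · exact Finset.sum_congr rfl fun i _ => inner_productOp_mpsOpenVar N A _ l l r r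

/-- **The fmps1 certificate sentence, unfolded.**  The hypothesis shape of `Upper/FMPSConsumer.lean`
(`Re ⟨ψ, toSpin H ψ⟩ ≤ (a · hi) · Re ⟨ψ, ψ⟩` for `ψ = mpsOpenVar a A l r`) is EQUIVALENT to the same inequality
between the real parts of the swept contractions of the witness data: left side by
`inner_toSpin_hamiltonian_pathGraph_mpsOpenVar`, right side by part 6's `star_dotProduct_mpsOpenVar_eq_envSweep`
(`= sweepPairing a A 1 l l r r`).  This is the precise sense in which the fmps1 reader "reads the certificate
sentence": it encloses these two numbers (Theorem H1′) and compares by value (`accept_sound`). -/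
theorem fmps_sentence_iff_sweeps (a : ℕ) [DecidableRel (SimpleGraph.pathGraph a).Adj] (t U hi : ℝ)
    (A : Fin a → MPSTensor 4 D) (l r : Fin D → ℂ) :
    (star (mpsOpenVar a A l r) ⬝ᵥ
        (toSpin (hamiltonian (SimpleGraph.pathGraph a) t U) *ᵥ mpsOpenVar a A l r)).re ≤
      ((a : ℝ) * hi) * (star (mpsOpenVar a A l r) ⬝ᵥ mpsOpenVar a A l r).re ↔
    (-(t : ℂ) * (∑ i : Fin a, ∑ j : Fin a, if i.val + 1 = j.val then
          ∑ σ : Fin 2,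
            (sweepPairing a A (Function.update (Function.update (fun _ => (1 : Matrix (Fin 4) (Fin 4) ℂ))
                j (siteAnnihilation σ)) i (siteCreation σ * siteParity)) l l r r +
              sweepPairing a A (Function.update (Function.update (fun _ => (1 : Matrix (Fin 4) (Fin 4) ℂ))
                j (siteCreation σ)) i (siteParity * siteAnnihilation σ)) l l r r)
        else 0) +
      (U : ℂ) * ∑ i : Fin a, sweepPairing a A (Function.update (fun _ => (1 : Matrix (Fin 4) (Fin 4) ℂ))
        i siteDouble) l l r r).re ≤
      ((a : ℝ) * hi) * (sweepPairing a A (fun _ => (1 : Matrix (Fin 4) (Fin 4) ℂ)) l l r r).re := by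
  rw [inner_toSpin_hamiltonian_pathGraph_mpsOpenVar, star_dotProduct_mpsOpenVar_eq_envSweep]
  rfl

end Summit.Ventures.CertifiedManyBodySolver.Upper.IntervalReader

end
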